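import Summits.CriticalPhenomena.PercolationContinuityZ3.Theorems.SahiMasterFamilyTopCriterion

/-!
# The two-ended corner criterion (TECC): statement, and the necessity half (all orders)

Support file of the master-family programme (crux `NoHeavyLowerTail`, stmt-CriticalPhenomena-4575; cell `prim-masterthm`, seat P4,
unit `prim-masterthm-p4-g7`).  Seat documents HOME/prim-masterthm-p4/CORNERS.md §2b, TECC-NOTES.md, P4-GEN7-REPORT.md.

For a family of increasing events `U_0,…,U_n` of a finite cube (up-closed, `∅ ∉ U_i ∋ univ`) the corner theory of gens 4–7 attaches an
integer invariant to every CORNER of the family: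
* BOTTOM CORNERS = inclusion-minimal common configurations `c` (minimal sets of `⋂ U_i`), invariant `Λ'(F^{(c)}) ≥ 0` = the coefficient
  of `∏_{e∈c} p_e` (Theorem S; `SahiSparseEnd.LambdaSys (Fc U c) c`); BOTTOM CRITERION (`exists_sahiE_spw_ne_zero_of_lambdaSys_pos_minimal`, gen 5):
  `Λ' > 0 ⇒ E_{n+1} ≢ 0`;
* TOP CORNERS = inclusion-minimal double-failure sets `c` (minimal sets of closed coordinates killing two events), invariant `(|T(c)|−2)!·(1 − N(c))`,
  `N(c) ∈ {0,1}` = "some two killed events split `c`" (Theorem D); TOP CRITERION (`exists_sahiE_spw_one_ne_zero_of_noSplit`, gen 7): no split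
  `⇒ E_{n+1} ≢ 0`.
This file states the TWO-ENDED CORNER CRITERION as a typed conjecture and proves its necessity half:

* `IsBottomCorner`, `IsTopCorner`, `CornerInvariantsVanish U` ((α) every bottom corner has `Λ' = 0` ∧ (β) every top corner splits);
* **`cornerInvariantsVanish_of_forall_sahiE_eq_zero`** (TECC `⇒`, all orders, PROVED): if `E_{n+1}(spw x 1; 1_U) = 0` for every parameter
  vector `x ∈ [0,1]^ι` then `CornerInvariantsVanish U`;
* `@[conjecture] TECC n` (TECC `⇐`, OPEN): `CornerInvariantsVanish U ⇒ E_{n+1}(spw x 1; 1_U) = 0` for all `x ∈ [0,1]^ι`.  EVIDENCE (exact census, HOME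
  kitjobs-g6/, CORNERS §2b): no nonzero family with vanishing corner invariants among ALL families on `{0,1}^3` for `n+1 ≤ 6`, on `{0,1}^4` for
  `n+1 = 3, 4` (776 216 and 32 795 126 multisets), and in 9.1·10⁶ random families on `{0,1}^5`; on the principal-cap class TECC is the Lean theorem
  PCD (`pcd_holds`, gen 6; there (β) is not even needed).  With prim-master-conj's `Z_k ⇒ E_k ≡ 0` the conjecture says: the zero-flag class `Z_{n+1}`
  is cut out by finitely many LOCAL corner conditions.
HONEST FRAMING: `TECC n` is OUR CONJECTURE (never a fact); only its `⇒` half is proved here.  Sahi `C_k`, Kahn's Conj. 5 and the master theorem remain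
OPEN.  [this work]
-/

namespace Summit.CriticalPhenomena.PercolationContinuityZ3.Theorems

namespace SahiSparseEnd

open Finset Function SahiComplement
open Literature.Combinatorics.Sahi2008

variable {ι : Type*} [Fintype ι] [DecidableEq ι]

section Corners

variable {n : ℕ} (U : Fin (n + 1) → Finset (Finset ι))

/-- `c` is a BOTTOM CORNER of `U`: an inclusion-minimal common configuration. [this work] -/
def IsBottomCorner (U : Fin (n + 1) → Finset (Finset ι)) (c : Finset ι) : Prop :=
  (∀ i, c ∈ U i) ∧ ∀ a, a ⊆ c → (∀ i, a ∈ U i) → a = c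

/-- `c` is a TOP CORNER of `U`: an inclusion-minimal set of closed coordinates killing at least two events. [this work] -/
def IsTopCorner (U : Fin (n + 1) → Finset (Finset ι)) (c : Finset ι) : Prop :=
  c ∈ doubly (reflFam U) ∧ ∀ b, b ∈ doubly (reflFam U) → b ⊆ c → b = c

/-- **The corner invariants vanish**: (α) `Λ'(F^{(c)}) = 0` at every bottom corner and (β) every top corner splits. [this work] -/
def CornerInvariantsVanish (U : Fin (n + 1) → Finset (Finset ι)) : Prop :=
  (∀ c, IsBottomCorner U c → LambdaSys (Fc U c) c = 0) ∧ ∀ c, IsTopCorner U c → ¬ NoSplit U c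

variable {U} (hU : ∀ i a a', a ∈ U i → a ⊆ a' → a' ∈ U i) (h0 : ∀ i, ∅ ∉ U i)

omit [Fintype ι] in
include hU h0 in
/-- `Λ'(F^{(c)}) ≥ 0` at every bottom corner (side conditions of `LambdaSys_nonneg`). [this work] -/
theorem lambdaSys_Fc_nonneg_of_isBottomCorner {c : Finset ι} (hc : IsBottomCorner U c) : 0 ≤ LambdaSys (Fc U c) c := by
  refine LambdaSys_nonneg (F := Fc U c) (c := c) ?_ ?_ ?_ (Nat.succ_pos n)
  · intro i a a' ha haa' ha'c
    rw [Fc, mem_filter] at ha ⊢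
    exact ⟨hU i a a' ha.1 haa', ha'c⟩
  · intro a hac
    constructor
    · intro hall
      exact hc.2 a hac fun i => (mem_filter.1 (hall i)).1
    · rintro rfl
      exact fun i => mem_filter.2 ⟨hc.1 i, subset_rfl⟩
  · intro i hi
    exact h0 i (mem_filter.1 hi).1

/-- `spw w p = spw (p·w) 1`. [this work] -/
theorem spw_eq_spw_one (w : ι → ℝ) (p : ℝ) : spw w p = spw (fun e => p * w e) 1 := by
  funext ω; simp only [spw, one_mul]

variable (huniv : ∀ i, (univ : Finset ι) ∈ U i)

include hU h0 huniv in
/-- **TECC, necessity half (all orders).**  If `E_{n+1}(spw x 1; 1_U) = 0` for every parameter vector `x ∈ [0,1]^ι` (the product weight with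
intensities `x_e`), then every bottom corner has `Λ' = 0` and every top corner splits. [this work] -/
theorem cornerInvariantsVanish_of_forall_sahiE_eq_zero
    (hE : ∀ x : ι → ℝ, (∀ e, 0 ≤ x e ∧ x e ≤ 1) → sahiE (spw x 1) (n + 1) (fun i => setInd (U i)) = 0) :
    CornerInvariantsVanish U := by
  constructor
  · intro c hc
    by_contra hne
    have hpos : 0 < LambdaSys (Fc U c) c := lt_of_le_of_ne (lambdaSys_Fc_nonneg_of_isBottomCorner hU h0 hc) (Ne.symm hne)
    obtain ⟨δ, hδ, h⟩ := exists_pos_forall_sahiE_pos_of_lambdaSys_pos_minimal hU h0 hc.1 hc.2 hpos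
    set p := min (δ / 2) 1 with hp
    have hp0 : 0 < p := lt_min (half_pos hδ) one_pos
    have hpδ : p < δ := (min_le_left _ _).trans_lt (half_lt_self hδ)
    have hp1 : p ≤ 1 := min_le_right _ _
    have hval := h p hp0 hpδ
    rw [spw_eq_spw_one, hE _ (fun e => ?_)] at hval
    · exact lt_irrefl _ hval
    · unfold cInd
      split_ifs
      · constructor <;> nlinarith
      · constructor <;> nlinarith
  · intro c hc hns
    obtain ⟨x, hx, hne⟩ := exists_sahiE_spw_one_ne_zero_of_noSplit hc.1 hc.2 hU huniv hns
    exact hne (hE x hx)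

end Corners

/-- **TECC — the two-ended corner criterion, sufficiency half (OUR CONJECTURE; a statement, never a fact).**  For every family of `n + 1` increasing
events of a finite cube (up-closed, `∅ ∉ U_i ∋ univ`): if every bottom corner has `Λ' = 0` and every top corner splits, then `E_{n+1}(spw x 1; 1_U) = 0`
for every `x ∈ [0,1]^ι`.  With `cornerInvariantsVanish_of_forall_sahiE_eq_zero` this would make the identically-zero locus of Sahi's functional a
finite list of LOCAL corner conditions at every order.  Census-exact on `{0,1}^3` (`n+1 ≤ 6`), `{0,1}^4` (`n+1 = 3,4`, exhaustive), `{0,1}^5` (sampled);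
a Lean theorem on the principal-cap class (`pcd_holds`). [this work] [status: open] -/
@[conjecture] def TECC (n : ℕ) : Prop :=
  ∀ (ι : Type) [Fintype ι] [DecidableEq ι] (U : Fin (n + 1) → Finset (Finset ι)),
    (∀ i a a', a ∈ U i → a ⊆ a' → a' ∈ U i) → (∀ i, ∅ ∉ U i) → (∀ i, (univ : Finset ι) ∈ U i) →
      CornerInvariantsVanish U → ∀ x : ι → ℝ, (∀ e, 0 ≤ x e ∧ x e ≤ 1) → sahiE (spw x 1) (n + 1) (fun i => setInd (U i)) = 0

/-- **Given `TECC n`, the zero locus IS the corner-invariant class**: `E_{n+1} ≡ 0` on the closed cube `⟺ CornerInvariantsVanish U`. [this work] -/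
theorem forall_sahiE_eq_zero_iff_cornerInvariantsVanish {n : ℕ} (h : TECC n) {ι : Type} [Fintype ι] [DecidableEq ι]
    (U : Fin (n + 1) → Finset (Finset ι)) (hU : ∀ i a a', a ∈ U i → a ⊆ a' → a' ∈ U i) (h0 : ∀ i, ∅ ∉ U i)
    (huniv : ∀ i, (univ : Finset ι) ∈ U i) :
    (∀ x : ι → ℝ, (∀ e, 0 ≤ x e ∧ x e ≤ 1) → sahiE (spw x 1) (n + 1) (fun i => setInd (U i)) = 0) ↔ CornerInvariantsVanish U :=
  ⟨cornerInvariantsVanish_of_forall_sahiE_eq_zero hU h0 huniv, fun hc x hx => h ι U hU h0 huniv hc x hx⟩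


/-! ### Bridge: the corner invariants of a family in the master-family vocabulary (appended, gen 7) -/

section Bridge

open scoped Classical
open Literature.Probability.Percolation.DecisionTree (ind)

universe u

variable {κ : Type u} [Fintype κ]

/-- **TECC necessity in the master-family vocabulary.**  For `n + 1` increasing events `U_j ⊆ 2^κ` (finite `κ`), none empty and none sure: if
`E_{n+1}(μ_p; 1_U) = 0` for every interior `p`, then the finset form `toFinsetFam U` has vanishing corner invariants ((α) every bottom corner
has `Λ' = 0`, (β) every top corner splits). [this work] -/
theorem cornerInvariantsVanish_of_forall_interior {n : ℕ} (U : Fin (n + 1) → Set (Set κ)) (hU : ∀ j, IsUpperSet (U j))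
    (h0 : ∀ j, (∅ : Set κ) ∉ U j) (hne : ∀ j, (Set.univ : Set κ) ∈ U j)
    (hE : ∀ p : κ → unitInterval, (∀ e, (p e : ℝ) ∈ Set.Ioo (0 : ℝ) 1) → sahiE (bernoulliWeight p) (n + 1) (fun j => ind (U j)) = 0) :
    CornerInvariantsVanish (toFinsetFam U) := by
  have hVup : ∀ j a a', a ∈ toFinsetFam U j → a ⊆ a' → a' ∈ toFinsetFam U j :=
    fun j a a' ha haa' => mem_toFinsetFam.2 (hU j (Finset.coe_subset.2 haa') (mem_toFinsetFam.1 ha))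
  have hV0 : ∀ j, ∅ ∉ toFinsetFam U j := fun j h => h0 j (by rw [← Finset.coe_empty]; exact mem_toFinsetFam.1 h)
  have hVuniv : ∀ j, (univ : Finset κ) ∈ toFinsetFam U j := fun j => mem_toFinsetFam.2 (by rw [Finset.coe_univ]; exact hne j)
  refine cornerInvariantsVanish_of_forall_sahiE_eq_zero hVup hV0 hVuniv fun x _ => ?_
  rw [sahiE_spw_toFinsetFam]
  exact forall_sahiE_weight_eq_zero_of_interior _ hE x

/-- **Zero flags have vanishing corner invariants** (every order): `U ∈ Z_{n+1}` (`SuppZeroFlag`) ⇒ (α) ∧ (β) for `toFinsetFam U`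
(tree `sahiE_ind_eq_zero_of_suppZeroFlag` + the necessity half of TECC).  The converse inclusion is `TECC n` composed with (EQI). [this work] -/
theorem cornerInvariantsVanish_of_suppZeroFlag {n : ℕ} (U : Fin (n + 1) → Set (Set κ)) (hU : ∀ j, IsUpperSet (U j))
    (h0 : ∀ j, (∅ : Set κ) ∉ U j) (hne : ∀ j, (Set.univ : Set κ) ∈ U j) (hZ : SuppZeroFlag (n + 1) U) :
    CornerInvariantsVanish (toFinsetFam U) :=
  cornerInvariantsVanish_of_forall_interior U hU h0 hne fun p _ => sahiE_ind_eq_zero_of_suppZeroFlag p hZ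

end Bridge

end SahiSparseEnd

end Summit.CriticalPhenomena.PercolationContinuityZ3.Theorems
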